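import Summits.MatrixMultiplication.OmegaCensus.SmallFormats.MatMul22nRankGF7PlanesData
import Summits.MatrixMultiplication.OmegaCensus.SmallFormats.MatMul22nRankGF5Classes
import HarnessLib

/-!
# ω-census family (a): the `𝔽₇` capped-pair certificate (kernel-checked packed tables) for `R_𝔽₇(⟨2,2,n⟩) ≥ 3n + 2`

Cell `pub-omega` (unit `pub-omega-tensor-g7`), topic `Summits/MatrixMultiplication/OmegaCensus` (sub-folder
`SmallFormats`). Framing (verbatim): lottery ticket; floor = certified bounds/negative ranges. HONEST FRAMING: finite facts
about `M₂(𝔽₇)` checked by `decide`; the VALUE `R(⟨2,2,n⟩) ≥ 3n + 2` over every field is PRINTED (Alekseev 2014/2015). Nothing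
here is progress on `ω`. This is the `𝔽₇` twin of `MatMul22nRankGF5Classes.lean`; the differences are the packed data
(`MatMul22nRankGF7PlanesData`) and the final clique check, done by a verified bitmask search (`cfree7`, `cfree7_sound`,
`cfree7_ok`) instead of a nested `∀`: the graph "uncapped" on the 336 invertible classes of `M₂(𝔽₇)` has clique number `8`
(after the two normalisations: no 7 pairwise-uncapped classes among the ≤ 67 listed ones, `seven7_ok`).
-/

namespace Summit.MatrixMultiplication.OmegaCensus.SmallFormats

open Matrix Literature.Computability.AlgebraicComplexity

/-! ## Computable primitives over `𝔽₇` -/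

/-- `7` is prime (instance needed for `Field (ZMod 7)`). -/
instance fact_prime_seven_gf7 : Fact (Nat.Prime 7) := ⟨Nat.prime_seven⟩

/-- The pairing `⟨A, M⟩ = ∑_b A_b M_b` over `𝔽₇`, written out. -/
def pdot7 (A : Fin 2 × Fin 2 → ZMod 7) (M : Matrix (Fin 2) (Fin 2) (ZMod 7)) : ZMod 7 :=
  A (0, 0) * M 0 0 + A (0, 1) * M 0 1 + A (1, 0) * M 1 0 + A (1, 1) * M 1 1

/-- `dotX = pdot7`. -/
theorem dotX_eq_pdot7 (A : Fin 2 × Fin 2 → ZMod 7) (M : Matrix (Fin 2) (Fin 2) (ZMod 7)) :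
    dotX A M = pdot7 A M := dotX_eq A M

set_option maxRecDepth 100000 in
set_option maxHeartbeats 4000000 in
/-- The un-sandwiches take `M` to `I` (`decide`). -/
theorem jM7_ok : ∀ l : Fin 384, jP7 l * jM7 l * jQ7 l = 1 := by decide +kernel
set_option maxRecDepth 100000 in
set_option maxHeartbeats 4000000 in
/-- The un-sandwiches take `N` to `E₀₁` (`decide`). -/
theorem jN7_ok : ∀ l : Fin 384, jP7 l * jN7 l * jQ7 l = (E01 : Matrix (Fin 2) (Fin 2) (ZMod 7)) := by decide +kernel
set_option maxRecDepth 100000 in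
set_option maxHeartbeats 4000000 in
/-- The un-sandwiches take `M` to `I` (`decide`). -/
theorem qM7_ok : ∀ l : Fin 882, qP7 l * qM7 l * qQ7 l = 1 := by decide +kernel
set_option maxRecDepth 100000 in
set_option maxHeartbeats 4000000 in
/-- The un-sandwiches take `N` to `C = !![0,1;3,0]` (`decide`). -/
theorem qN7_ok : ∀ l : Fin 882, qP7 l * qN7 l * qQ7 l = Cmat (3 : ZMod 7) 0 := by decide +kernel
/-- `t² = 3` has no root in `𝔽₇` (so `!![0,1;3,0]` has no eigenvalue). -/
theorem zmod7_sq_ne : ∀ t : ZMod 7, t * t ≠ 0 * t + 3 := by decide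

/-- The 384 dual-type planes of `M₂(𝔽₇)` as `JPlane` data. -/
def jPlane7 (l : Fin 384) : JPlane (ZMod 7) := ⟨jM7 l, jN7 l, jP7 l, jQ7 l, jM7_ok l, jN7_ok l⟩
/-- The 882 `𝔽₄₉`-type planes of `M₂(𝔽₇)` as `QPlane` data. -/
def qPlane7 (l : Fin 882) : QPlane (ZMod 7) 3 0 := ⟨qM7 l, qN7 l, qP7 l, qQ7 l, qM7_ok l, qN7_ok l⟩

/-- `A` annihilates dual-type plane `l` (Boolean test). -/
def perpJ7 (A : Fin 2 × Fin 2 → ZMod 7) (l : Fin 384) : Bool := decide (pdot7 A (jM7 l) = 0 ∧ pdot7 A (jN7 l) = 0)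
/-- `A` annihilates `𝔽₄₉`-type plane `l` (Boolean test). -/
def perpQ7 (A : Fin 2 × Fin 2 → ZMod 7) (l : Fin 882) : Bool := decide (pdot7 A (qM7 l) = 0 ∧ pdot7 A (qN7 l) = 0)

/-- A positive `perpJ7` test gives the two vanishing pairings. -/
theorem perpJ7_dotX {A : Fin 2 × Fin 2 → ZMod 7} {l : Fin 384} (h : perpJ7 A l = true) :
    dotX A (jPlane7 l).M = 0 ∧ dotX A (jPlane7 l).N = 0 := by
  rw [dotX_eq_pdot7, dotX_eq_pdot7]; exact of_decide_eq_true h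
/-- A positive `perpQ7` test gives the two vanishing pairings. -/
theorem perpQ7_dotX {A : Fin 2 × Fin 2 → ZMod 7} {l : Fin 882} (h : perpQ7 A l = true) :
    dotX A (qPlane7 l).M = 0 ∧ dotX A (qPlane7 l).N = 0 := by
  rw [dotX_eq_pdot7, dotX_eq_pdot7]; exact of_decide_eq_true h

/-- `w` is the code of a plane annihilated by `A` (`1 ≤ w ≤ 384`: dual plane `w−1`; `385 ≤ w ≤ 1266`: `𝔽₄₉`-plane `w−385`). -/
def okW7 (A : Fin 2 × Fin 2 → ZMod 7) (w : ℕ) : Bool :=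
  if h : 0 < w ∧ w < 385 then perpJ7 A ⟨w - 1, by omega⟩
  else if h' : 385 ≤ w ∧ w < 1267 then perpQ7 A ⟨w - 385, by omega⟩ else false

/-- Two positive `okW7` tests with the same code give a common annihilated plane. -/
theorem common_of_okW7 {A B : Fin 2 × Fin 2 → ZMod 7} {w : ℕ} (hA : okW7 A w = true) (hB : okW7 B w = true) :
    (∃ l : Fin 384, perpJ7 A l = true ∧ perpJ7 B l = true) ∨ (∃ l : Fin 882, perpQ7 A l = true ∧ perpQ7 B l = true) := by
  unfold okW7 at hA hB
  by_cases h : 0 < w ∧ w < 385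
  · rw [dif_pos h] at hA hB; exact Or.inl ⟨_, hA, hB⟩
  · rw [dif_neg h] at hA hB
    by_cases h' : 385 ≤ w ∧ w < 1267
    · rw [dif_pos h'] at hA hB; exact Or.inr ⟨_, hA, hB⟩
    · rw [dif_neg h'] at hA; exact absurd hA Bool.false_ne_true

/-- A multiple of `R` annihilates what `R` annihilates. -/
theorem okW7_of_eq_mul {A R : Fin 2 × Fin 2 → ZMod 7} {s : ZMod 7} (h : ∀ p, A p = s * R p) {w : ℕ}
    (hR : okW7 R w = true) : okW7 A w = true := by
  have key : ∀ M, pdot7 R M = 0 → pdot7 A M = 0 := by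
    intro M hM
    have e : pdot7 A M = s * pdot7 R M := by simp only [pdot7, h]; ring
    rw [e, hM, mul_zero]
  unfold okW7 at hR ⊢
  by_cases h1 : 0 < w ∧ w < 385
  · rw [dif_pos h1] at hR ⊢
    have h2 := of_decide_eq_true hR
    exact decide_eq_true ⟨key _ h2.1, key _ h2.2⟩
  · rw [dif_neg h1] at hR ⊢
    by_cases h3 : 385 ≤ w ∧ w < 1267
    · rw [dif_pos h3] at hR ⊢
      have h2 := of_decide_eq_true hR
      exact decide_eq_true ⟨key _ h2.1, key _ h2.2⟩
    · rw [dif_neg h3] at hR ⊢; exact hR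

/-- Pointwise-equal coefficient functions annihilate the same planes. -/
theorem okW7_congr {A R : Fin 2 × Fin 2 → ZMod 7} (h : ∀ p, A p = R p) {w : ℕ} (hR : okW7 R w = true) :
    okW7 A w = true :=
  okW7_of_eq_mul (s := 1) (fun p => by rw [h p, one_mul]) hR

/-! ## Class codes -/

/-- The leading entry used to normalise an invertible matrix: `A₀₀` if nonzero, else `A₀₁`. -/
def lead7 (A : Fin 2 × Fin 2 → ZMod 7) : ZMod 7 := if A (0, 0) = 0 then A (0, 1) else A (0, 0)

/-- The class code of an invertible `A ∈ M₂(𝔽₇)` (`A / lead7 A` read off in base 7; `x⁻¹ = x⁵` in `𝔽₇`). -/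
def code7 (A : Fin 2 × Fin 2 → ZMod 7) : Fin 392 :=
  if A (0, 0) = 0 then
    ⟨343 + 7 * (A (0, 1) ^ 5 * A (1, 0)).val + (A (0, 1) ^ 5 * A (1, 1)).val, by
      have := (A (0, 1) ^ 5 * A (1, 0)).val_lt; have := (A (0, 1) ^ 5 * A (1, 1)).val_lt; omega⟩
  else
    ⟨49 * (A (0, 0) ^ 5 * A (0, 1)).val + 7 * (A (0, 0) ^ 5 * A (1, 0)).val + (A (0, 0) ^ 5 * A (1, 1)).val, by
      have := (A (0, 0) ^ 5 * A (0, 1)).val_lt; have := (A (0, 0) ^ 5 * A (1, 0)).val_lt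
      have := (A (0, 0) ^ 5 * A (1, 1)).val_lt; omega⟩

/-- The representative of a class code. -/
def repF7 (c : Fin 392) : Fin 2 × Fin 2 → ZMod 7 :=
  if c.val < 343 then mk4 1 ((c.val / 49 : ℕ) : ZMod 7) ((c.val / 7 % 7 : ℕ) : ZMod 7) ((c.val % 7 : ℕ) : ZMod 7)
  else mk4 0 1 (((c.val - 343) / 7 : ℕ) : ZMod 7) (((c.val - 343) % 7 : ℕ) : ZMod 7)

set_option maxRecDepth 100000 in
set_option maxHeartbeats 4000000 in
/-- Every invertible `A` is `lead7 A` times the representative of its code (`decide` over the 2401 matrices). -/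
theorem repF7_spec : ∀ A : Fin 2 × Fin 2 → ZMod 7, det2 A ≠ 0 →
    lead7 A ≠ 0 ∧ ∀ p : Fin 2 × Fin 2, A p = lead7 A * repF7 (code7 A) p :=
  forall_of_forall_mk4 (by decide +kernel)

/-- The identity's coefficient function over `𝔽₇`. -/
def idC7 : Fin 2 × Fin 2 → ZMod 7 := mk4 1 0 0 1
/-- The diagonal classes `D_β = diag(1, β+2)`, `β < 5`. -/
def D7 (b : Fin 5) : Fin 2 × Fin 2 → ZMod 7 := mk4 1 0 0 ((b.val : ZMod 7) + 2)

/-! ## The witness tables are sound (`decide`) -/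

set_option maxRecDepth 100000 in
set_option maxHeartbeats 4000000 in
/-- Pairs `(I, c)`: the witness plane is annihilated by both. -/
theorem wI7_ok : ∀ c : Fin 392, det2 (repF7 c) ≠ 0 → wI7 c ≠ 0 →
    okW7 idC7 (wI7 c) = true ∧ okW7 (repF7 c) (wI7 c) = true := by decide +kernel

set_option maxRecDepth 100000 in
set_option maxHeartbeats 4000000 in
/-- The second normalisation: for a class `c` sharing no plane with `I`, the sandwich `x ↦ P x P⁻¹` (`P = cjP7 c`) fixes the
identity form and takes the form `repF7 c` to `cjS7 c • D_(cjB7 c)`, `cjS7 c ≠ 0`. -/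
theorem cj7_ok : ∀ c : Fin 392, det2 (repF7 c) ≠ 0 → wI7 c = 0 →
    cjPi7 c * cjP7 c = 1 ∧ (∀ p, sand (cjP7 c) (cjPi7 c) idC7 p = idC7 p) ∧
      (∀ p, sand (cjP7 c) (cjPi7 c) (repF7 c) p = cjS7 c * D7 (cjB7 c) p) ∧ cjS7 c ≠ 0 := by decide +kernel

set_option maxRecDepth 100000 in
set_option maxHeartbeats 4000000 in
/-- Pairs `(D_β, c)`: the witness plane is annihilated by both. -/
theorem wD7_ok : ∀ b : Fin 5, ∀ c : Fin 392, det2 (repF7 c) ≠ 0 → wD7 b c ≠ 0 →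
    okW7 (D7 b) (wD7 b c) = true ∧ okW7 (repF7 c) (wD7 b c) = true := by decide +kernel

set_option maxRecDepth 100000 in
set_option maxHeartbeats 4000000 in
/-- Completeness: an invertible class sharing no plane with `I` nor with `D_β` is listed in `nb7 β`. -/
theorem mem7_ok : ∀ b : Fin 5, ∀ c : Fin 392, det2 (repF7 c) ≠ 0 → wI7 c = 0 → wD7 b c = 0 →
    ∃ p : Fin 67, nb7 b p = c := by decide +kernel

set_option maxRecDepth 100000 in
set_option maxHeartbeats 4000000 in
/-- Pairs inside the lists: the witness plane is annihilated by both. -/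
theorem wN7_ok : ∀ b : Fin 5, ∀ p p' : Fin 67, wN7 b p p' ≠ 0 →
    okW7 (repF7 (nb7 b p)) (wN7 b p p') = true ∧ okW7 (repF7 (nb7 b p')) (wN7 b p p') = true := by decide +kernel

set_option maxRecDepth 100000 in
set_option maxHeartbeats 4000000 in
/-- Every listed class shares a plane with itself (diagonal witnesses). -/
theorem wN7_diag : ∀ b : Fin 5, ∀ p : Fin 67, wN7 b p p ≠ 0 := by decide +kernel

set_option maxRecDepth 100000 in
set_option maxHeartbeats 4000000 in
/-- The masks are sound: a cleared bit means a capped pair (nonzero witness). -/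
theorem nm7_ok : ∀ b : Fin 5, ∀ p p' : Fin 67, Nat.testBit (nm7 b p.val) p'.val = false → wN7 b p p' ≠ 0 := by
  decide +kernel

/-! ## A verified bitmask clique search -/

/-- `cfree7 N fuel k cand i = true` certifies: there are no `k` indices `i ≤ p₁ < ⋯ < p_k`, all in the mask `cand`, with
every later one in the mask `N` of every earlier one (structural recursion on `fuel`; `true` as soon as no candidate `≥ i` is
left, `false` when out of fuel or when a clique would be completed). -/
def cfree7 (N : ℕ → ℕ) : ℕ → ℕ → ℕ → ℕ → Bool
  | 0, _, _, _ => false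
  | _ + 1, 0, _, _ => false
  | fuel + 1, k + 1, cand, i =>
    if cand >>> i = 0 then true
    else if k = 0 then false
    else (!(Nat.testBit cand i) || cfree7 N fuel k (cand &&& N i) (i + 1)) && cfree7 N fuel (k + 1) cand (i + 1)

/-- Soundness of the bitmask clique search. -/
theorem cfree7_sound (N : ℕ → ℕ) : ∀ (fuel k cand i : ℕ), cfree7 N fuel k cand i = true →
    ∀ l : List ℕ, l.length = k → l.Pairwise (· < ·) → (∀ v ∈ l, i ≤ v ∧ Nat.testBit cand v = true) →
      l.Pairwise (fun a c => Nat.testBit (N a) c = true) → False := by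
  intro fuel
  induction fuel with
  | zero => intro k cand i h; simp [cfree7] at h
  | succ fuel ih =>
    intro k cand i h l hl hs hm hp
    cases k with
    | zero => simp [cfree7] at h
    | succ k =>
      cases l with
      | nil => simp at hl
      | cons v t =>
        have hv := hm v (by simp)
        have hne : cand >>> i ≠ 0 := by
          intro h0
          have hb : Nat.testBit (cand >>> i) (v - i) = true := by
            rw [Nat.testBit_shiftRight, Nat.add_sub_cancel' hv.1]; exact hv.2
          rw [h0, Nat.zero_testBit] at hb
          exact Bool.false_ne_true hb
        rw [cfree7, if_neg hne] at h
        by_cases hk : k = 0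
        · rw [if_pos hk] at h; exact Bool.false_ne_true h
        rw [if_neg hk, Bool.and_eq_true] at h
        obtain ⟨h1, h2⟩ := h
        rw [List.pairwise_cons] at hs hp
        have hlt : t.length = k := by simpa using hl
        by_cases hvi : v = i
        · subst hvi
          rw [hv.2, Bool.not_true, Bool.false_or] at h1
          refine ih k (cand &&& N v) (v + 1) h1 t hlt hs.2 ?_ hp.2
          intro u hu
          refine ⟨hs.1 u hu, ?_⟩
          rw [Nat.testBit_and, (hm u (by simp [hu])).2, hp.1 u hu, Bool.true_and]
        · have hiv : i + 1 ≤ v := by have := hv.1; omega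
          refine ih (k + 1) cand (i + 1) h2 (v :: t) hl (List.pairwise_cons.2 hs) ?_ (List.pairwise_cons.2 hp)
          intro u hu
          rcases List.mem_cons.1 hu with rfl | hu'
          · exact ⟨hiv, hv.2⟩
          · have := hs.1 u hu'
            exact ⟨by omega, (hm u hu).2⟩

set_option maxRecDepth 100000 in
set_option maxHeartbeats 4000000 in
/-- The bitmask search, list `β = 0` (`decide +kernel`, ≈ 1.9·10⁵ unfoldings). -/
theorem cfree7_ok0 : cfree7 (nm7 0) 74 7 147573952589676412927 0 = true := by decide +kernel
set_option maxRecDepth 100000 in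
set_option maxHeartbeats 4000000 in
/-- The bitmask search, list `β = 1`. -/
theorem cfree7_ok1 : cfree7 (nm7 1) 74 7 147573952589676412927 0 = true := by decide +kernel
set_option maxRecDepth 100000 in
set_option maxHeartbeats 4000000 in
/-- The bitmask search, list `β = 2`. -/
theorem cfree7_ok2 : cfree7 (nm7 2) 74 7 147573952589676412927 0 = true := by decide +kernel
set_option maxRecDepth 100000 in
set_option maxHeartbeats 4000000 in
/-- The bitmask search, list `β = 3`. -/
theorem cfree7_ok3 : cfree7 (nm7 3) 74 7 147573952589676412927 0 = true := by decide +kernel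
set_option maxRecDepth 100000 in
set_option maxHeartbeats 4000000 in
/-- The bitmask search, list `β = 4`. -/
theorem cfree7_ok4 : cfree7 (nm7 4) 74 7 147573952589676412927 0 = true := by decide +kernel

/-- **No 7 pairwise-uncapped listed classes**, all `β` (clique number of "uncapped" on the invertible classes of `M₂(𝔽₇)` is `8`). -/
theorem cfree7_ok (b : Fin 5) : cfree7 (nm7 b) 74 7 147573952589676412927 0 = true := by
  fin_cases b
  exacts [cfree7_ok0, cfree7_ok1, cfree7_ok2, cfree7_ok3, cfree7_ok4]

/-- Among any 7 listed classes (`β` fixed) two form a capped pair. -/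
theorem seven7_ok (b : Fin 5) (S : Finset (Fin 67)) (hS : S.card = 7) :
    ∃ p ∈ S, ∃ p' ∈ S, p < p' ∧ wN7 b p p' ≠ 0 := by
  classical
  by_contra hcon
  have hun : ∀ p ∈ S, ∀ p' ∈ S, p < p' → wN7 b p p' = 0 := by
    intro p hp p' hp' hpp
    by_contra hne
    exact hcon ⟨p, hp, p', hp', hpp, hne⟩
  set l : List ℕ := (S.sort (· ≤ ·)).map Fin.val with hl
  have hlen : l.length = 7 := by rw [hl, List.length_map, Finset.length_sort, hS]
  have hsortF : (S.sort (· ≤ ·)).Pairwise (· < ·) := List.sortedLT_iff_pairwise.1 (Finset.sortedLT_sort S)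
  have hsort : l.Pairwise (· < ·) := by
    rw [hl, List.pairwise_map]
    exact hsortF.imp (fun h => h)
  have hmem : ∀ v : Fin 67, v ∈ S.sort (· ≤ ·) ↔ v ∈ S := fun v => Finset.mem_sort _
  refine cfree7_sound (nm7 b) 74 7 147573952589676412927 0 (cfree7_ok b) l hlen hsort ?_ ?_
  · intro v hv
    rw [hl, List.mem_map] at hv
    obtain ⟨w, -, rfl⟩ := hv
    refine ⟨Nat.zero_le _, ?_⟩
    have e : (147573952589676412927 : ℕ) = 2 ^ 67 - 1 := by norm_num
    rw [e, Nat.testBit_two_pow_sub_one]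
    exact decide_eq_true w.isLt
  · rw [hl, List.pairwise_map]
    refine hsortF.imp_of_mem ?_
    intro a c ha hc hac
    have h0 := hun a ((hmem a).1 ha) c ((hmem c).1 hc) hac
    by_contra hbit
    exact nm7_ok b a c (by simpa using hbit) h0

end Summit.MatrixMultiplication.OmegaCensus.SmallFormats
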